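import Summits.Ventures.PercRepro.S1SpreadTriangles

/-!
# PercRepro — TRIANGLES OF A SPREAD CORE, PART B: `s₃ ≤ nullity` (p1, gen 35)

`proofs/P1-S2-CORANK6.md` §4r. **`ncard_triangles_le_nullity`**: a spread e-free core of nullity `d ≥ 4` has at most `d` triangles
(3-circuits). Two regimes: (A) the core contains a six-point set `W` of rank `≤ 3` — then every triangle lies inside `W`
(`tri_subset_of_six`: a triangle meeting `W` in `≤ 2` points would give `≤ 8` points of rank `≤ 5 − |T ∩ W|` against the spread bound),
and a six-point set with lines of `≤ 3` points carries at most `4` triangles (`ncard_triangles_le_four_of_six`: fix one triangle `T₁`; every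
other one meets it in exactly one point, or is its complement and then nothing else fits); (B) no such `W` — then every triangle has a
PRIVATE point (`exists_private_of_no_six`, the contrapositive of the covered-triangle lemma), and adding the triangles one by one to a
union raises the nullity by one each time (`eRk_add_card_le_ncard_biUnion`), so `s₃ ≤ nullity(E) = d`. Against the cell's standing
triangle caps `cq3(d) = 10 / 11 / 13` at `d = 6 / 7 / 8` this reads `6 / 7 / 8` on the spread case. Nothing about any cell is claimed.
Axioms: standard.
-/

open scoped Matroid

namespace PercRepro

namespace S1

open Set

variable {α : Type}

/-- **Every triangle lies inside a six-point set of rank `≤ 3`** (spread): meeting it in `k ≤ 2` points gives `9 − k` points of rank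
`≤ 5 − k`. -/
theorem tri_subset_of_six (M : Matroid α) [M.Finite]
    (hfree : ∀ e ∈ M.E, ∃ A ⊆ M.E \ {e}, e ∉ M.closure A ∧ e ∉ M.closure ((M.E \ {e}) \ A))
    (hns : ¬ ∃ W ⊆ M.E, W.ncard ≤ 9 ∧ W.encard = M.eRk W + 4)
    {W : Set α} (hWE : W ⊆ M.E) (hW6 : W.ncard = 6) (hW3 : M.eRk W ≤ 3)
    {T : Set α} (hT : M.IsCircuit T) (hT3 : T.ncard = 3) : T ⊆ W := by
  classical
  have hWf : W.Finite := M.ground_finite.subset hWE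
  have hTf : T.Finite := M.ground_finite.subset hT.subset_ground
  by_contra hnot
  -- `k = |T ∩ W| ≤ 2`
  have hk : (T ∩ W).ncard ≤ 2 := by
    by_contra h
    push Not at h
    have : T ∩ W = T := Set.eq_of_subset_of_ncard_le inter_subset_left (by omega) hTf
    exact hnot (by rw [← this]; exact inter_subset_right)
  have hunion : (W ∪ T).ncard = 9 - (T ∩ W).ncard := by
    have := Set.ncard_union_add_ncard_inter W T hWf hTf
    rw [hW6, hT3, inter_comm] at this
    omega
  -- the rank of `T ∩ W` is its size (at most two points of a circuit are independent)
  have hrk : M.eRk (T ∩ W) = (T ∩ W).ncard := by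
    rcases Nat.lt_or_ge (T ∩ W).ncard 1 with h0 | h1
    · have h0' : (T ∩ W).ncard = 0 := by omega
      have hempty : T ∩ W = ∅ := (ncard_eq_zero (hTf.subset inter_subset_left)).1 h0'
      rw [h0', hempty]; simp
    rcases Nat.lt_or_ge (T ∩ W).ncard 2 with h1' | h2
    · have h1'' : (T ∩ W).ncard = 1 := by omega
      obtain ⟨u, hu⟩ := ncard_eq_one.1 h1''
      rw [h1'', hu]
      exact eRk_singleton_eq_one_of_hfree M hfree (hT.subset_ground (hu ▸ (mem_singleton u) : u ∈ T ∩ W).1)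
    · have h2' : (T ∩ W).ncard = 2 := by omega
      obtain ⟨u, v, huv, huv'⟩ := ncard_eq_two.1 h2'
      rw [h2', huv']
      have hu : u ∈ T := (huv' ▸ (show u ∈ ({u, v} : Set α) by simp) : u ∈ T ∩ W).1
      have hv : v ∈ T := (huv' ▸ (show v ∈ ({u, v} : Set α) by simp) : v ∈ T ∩ W).1
      exact eRk_pair_eq_two M hfree (hT.subset_ground hu) (hT.subset_ground hv) huv
  -- submodularity
  have hsub := M.eRk_submod W T
  rw [eRk_eq_two_of_tri M hT hT3, inter_comm, hrk] at hsub
  obtain ⟨r, hr⟩ := exists_eRk_eq_coe M (W ∪ T)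
  obtain ⟨s, hs⟩ := exists_eRk_eq_coe M W
  rw [hr, hs] at hsub
  rw [hs] at hW3
  have hs3 : s ≤ 3 := by exact_mod_cast hW3
  have hsum : (T ∩ W).ncard + r ≤ s + 2 := by exact_mod_cast hsub
  have hr' : M.eRk (W ∪ T) ≤ (5 - (T ∩ W).ncard : ℕ) := by
    rw [hr]; exact_mod_cast (show r ≤ 5 - (T ∩ W).ncard by omega)
  have := ncard_le_add_three_of_eRk_le M hns (union_subset hWE hT.subset_ground) (by omega) hr'
  omega

/-- **A six-point set with lines of `≤ 3` points carries at most `4` triangles.** -/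
theorem ncard_triangles_le_four_of_six (M : Matroid α) [M.Finite]
    (hfree : ∀ e ∈ M.E, ∃ A ⊆ M.E \ {e}, e ∉ M.closure A ∧ e ∉ M.closure ((M.E \ {e}) \ A))
    {W : Set α} (hWE : W ⊆ M.E) (hW6 : W.ncard = 6)
    (hall : ∀ T : Set α, M.IsCircuit T → T.ncard = 3 → T ⊆ W) :
    {C : Set α | M.IsCircuit C ∧ C.ncard = 3}.ncard ≤ 4 := by
  classical
  set 𝒯 := {C : Set α | M.IsCircuit C ∧ C.ncard = 3} with h𝒯
  have h𝒯f : 𝒯.Finite := M.ground_finite.finite_subsets.subset (fun C hC => hC.1.subset_ground)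
  have hWf : W.Finite := M.ground_finite.subset hWE
  rcases 𝒯.eq_empty_or_nonempty with h0 | ⟨T₁, hT₁⟩
  · rw [h0]; simp
  have hT₁W := hall T₁ hT₁.1 hT₁.2
  -- the complement `R = W ∖ T₁` has three points
  set R := W \ T₁ with hR
  have hR3 : R.ncard = 3 := by
    rw [hR, Set.ncard_sdiff hT₁W (M.ground_finite.subset hT₁.1.subset_ground), hW6, hT₁.2]
  have hRf : R.Finite := hWf.subset sdiff_subset
  -- every other triangle meets `T₁` in at most one point, hence has `≥ 2` points in `R`
  have hmeet : ∀ T ∈ 𝒯, T ≠ T₁ → (T ∩ T₁).ncard ≤ 1 := by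
    intro T hT hne
    by_contra h
    push Not at h
    obtain ⟨p, hp, q, hq, hpq⟩ := (Set.one_lt_ncard ((M.ground_finite.subset hT.1.subset_ground).subset inter_subset_left)).1 h
    exact hne (tri_eq_of_pair_mem M hfree hT.1 hT.2 hT₁.1 hT₁.2 hpq hp.1 hq.1 hp.2 hq.2)
  have hdiffR : ∀ T ∈ 𝒯, T \ T₁ ⊆ R := fun T hT t ht => ⟨hall T hT.1 hT.2 ht.1, ht.2⟩
  have hdiff2 : ∀ T ∈ 𝒯, T ≠ T₁ → 2 ≤ (T \ T₁).ncard := by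
    intro T hT hne
    have hTf : T.Finite := M.ground_finite.subset hT.1.subset_ground
    have := Set.ncard_inter_add_ncard_sdiff_eq_ncard T T₁ hTf
    have := hmeet T hT hne
    have h3 := hT.2
    omega
  by_cases hcompl : ∃ T₂ ∈ 𝒯, T₂ ∩ T₁ = ∅
  · -- a triangle disjoint from `T₁` is `R`; then nothing else fits
    obtain ⟨T₂, hT₂, hT₂₁⟩ := hcompl
    have hT₂R : T₂ = R := by
      apply Set.eq_of_subset_of_ncard_le
      · intro t ht
        refine ⟨hall T₂ hT₂.1 hT₂.2 ht, fun h => ?_⟩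
        have : t ∈ T₂ ∩ T₁ := ⟨ht, h⟩
        rw [hT₂₁] at this
        exact this
      · rw [hR3, hT₂.2]
      · exact hRf
    have hsub : 𝒯 ⊆ {T₁, T₂} := by
      intro T hT
      by_contra hT'
      simp only [mem_insert_iff, mem_singleton_iff, not_or] at hT'
      have hTf : T.Finite := M.ground_finite.subset hT.1.subset_ground
      have h1 := hmeet T hT hT'.1
      have h2 : (T ∩ T₂).ncard ≤ 1 := by
        by_contra h
        push Not at h
        obtain ⟨p, hp, q, hq, hpq⟩ := (Set.one_lt_ncard (hTf.subset inter_subset_left)).1 h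
        exact hT'.2 (tri_eq_of_pair_mem M hfree hT.1 hT.2 hT₂.1 hT₂.2 hpq hp.1 hq.1 hp.2 hq.2)
      -- `T ⊆ W = T₁ ∪ T₂`
      have hTW : T ⊆ T₁ ∪ T₂ := by
        intro t ht
        by_cases h : t ∈ T₁
        · exact Or.inl h
        · exact Or.inr (hT₂R ▸ ⟨hall T hT.1 hT.2 ht, h⟩)
      have : T = (T ∩ T₁) ∪ (T ∩ T₂) := by
        ext t; constructor
        · intro ht; rcases hTW ht with h | h
          · exact Or.inl ⟨ht, h⟩
          · exact Or.inr ⟨ht, h⟩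
        · rintro (h | h) <;> exact h.1
      have := Set.ncard_union_le (T ∩ T₁) (T ∩ T₂)
      rw [← ‹T = T ∩ T₁ ∪ T ∩ T₂›] at this
      rw [hT.2] at this
      omega
    exact (ncard_le_ncard hsub (toFinite _)).trans ((Set.ncard_insert_le T₁ {T₂}).trans (by simp))
  · -- every other triangle meets `T₁` in exactly one point: `T ↦ T ∖ T₁` injects `𝒯 ∖ {T₁}` into the two-subsets of `R`
    push Not at hcompl
    have hexact : ∀ T ∈ 𝒯, T ≠ T₁ → (T \ T₁).ncard = 2 := by
      intro T hT hne
      have hTf : T.Finite := M.ground_finite.subset hT.1.subset_ground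
      have h1 := Set.ncard_inter_add_ncard_sdiff_eq_ncard T T₁ hTf
      have h2 := hmeet T hT hne
      have h3 : 0 < (T ∩ T₁).ncard := (ncard_pos (hTf.subset inter_subset_left)).2 (hcompl T hT)
      have h4 := hT.2
      omega
    have hinj : Set.InjOn (fun T : Set α => T \ T₁) (𝒯 \ {T₁}) := by
      intro T hT T' hT' heq
      simp only at heq
      have hne : T ≠ T₁ := fun h => hT.2 (mem_singleton_iff.2 h)
      obtain ⟨p, q, hpq, hpq'⟩ := ncard_eq_two.1 (hexact T hT.1 hne)
      have hp : p ∈ T \ T₁ := hpq' ▸ (by simp)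
      have hq : q ∈ T \ T₁ := hpq' ▸ (by simp)
      have hp' : p ∈ T' \ T₁ := heq ▸ hp
      have hq' : q ∈ T' \ T₁ := heq ▸ hq
      exact tri_eq_of_pair_mem M hfree hT.1.1 hT.1.2 hT'.1.1 hT'.1.2 hpq hp.1 hq.1 hp'.1 hq'.1
    have hmaps : ∀ T ∈ 𝒯 \ {T₁}, (fun T : Set α => T \ T₁) T ∈ {S : Set α | S ⊆ R ∧ S.ncard = 2} := by
      intro T hT
      exact ⟨hdiffR T hT.1, hexact T hT.1 (fun h => hT.2 (mem_singleton_iff.2 h))⟩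
    have hRsub : {S : Set α | S ⊆ R ∧ S.ncard = 2}.ncard ≤ 3 := by
      -- the two-subsets of a three-point set: `Finset.powersetCard`
      have hcoe : {S : Set α | S ⊆ R ∧ S.ncard = 2} ⊆ (fun F : Finset α => (F : Set α)) '' (hRf.toFinset.powersetCard 2) := by
        intro S hS
        have hSf : S.Finite := hRf.subset hS.1
        refine ⟨hSf.toFinset, Finset.mem_coe.2 (Finset.mem_powersetCard.2 ⟨?_, ?_⟩), by simp⟩
        · intro t ht; rw [Finite.mem_toFinset] at ht ⊢; exact hS.1 ht
        · rw [← ncard_eq_toFinset_card _ hSf]; exact hS.2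
      have h1 := ncard_le_ncard hcoe (toFinite _)
      have h2 := Set.ncard_image_le (s := ((hRf.toFinset.powersetCard 2 : Finset (Finset α)) : Set (Finset α)))
        (f := fun F : Finset α => (F : Set α)) (toFinite _)
      rw [ncard_coe_finset, Finset.card_powersetCard, ← ncard_eq_toFinset_card _ hRf, hR3] at h2
      exact h1.trans (h2.trans (by decide))
    have h1 := Set.ncard_le_ncard_of_injOn _ hmaps hinj (hRf.finite_subsets.subset (fun S hS => hS.1))
    have h2 : (𝒯 \ {T₁}).ncard = 𝒯.ncard - 1 := ncard_sdiff_singleton_of_mem hT₁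
    omega

/-- **With no six-point set of rank `≤ 3`, every triangle has a private point** (the contrapositive of the covered-triangle lemma). -/
theorem exists_private_of_no_six (M : Matroid α) [M.Finite]
    (hfree : ∀ e ∈ M.E, ∃ A ⊆ M.E \ {e}, e ∉ M.closure A ∧ e ∉ M.closure ((M.E \ {e}) \ A))
    (hns : ¬ ∃ W ⊆ M.E, W.ncard ≤ 9 ∧ W.encard = M.eRk W + 4)
    (hno : ¬ ∃ W ⊆ M.E, W.ncard = 6 ∧ M.eRk W ≤ 3)
    {T : Set α} (hT : M.IsCircuit T) (hT3 : T.ncard = 3) :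
    ∃ p ∈ T, ∀ T' : Set α, M.IsCircuit T' → T'.ncard = 3 → T' ≠ T → p ∉ T' := by
  by_contra h
  push Not at h
  obtain ⟨x, y, z, hxy, hxz, hyz, hTxyz⟩ := ncard_eq_three.1 hT3
  obtain ⟨Ta, hTa, hTa3, hTa', hxa⟩ := h x (by rw [hTxyz]; simp)
  obtain ⟨Tb, hTb, hTb3, hTb', hyb⟩ := h y (by rw [hTxyz]; simp)
  obtain ⟨Tc, hTc, hTc3, hTc', hzc⟩ := h z (by rw [hTxyz]; simp)
  exact hno (exists_six_of_covered_tri M hfree hns hT hT3 hTa hTa3 hTb hTb3 hTc hTc3 hTxyz hxy hxz hyz hxa hyb hzc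
    hTa' hTb' hTc')

/-- **Private points raise the nullity**: for a finite family of circuits each with a point on none of the others,
`rank(⋃) + #family ≤ |⋃|`. -/
theorem eRk_add_card_le_ncard_biUnion (M : Matroid α) [M.Finite] (S : Finset (Set α))
    (hS : ∀ T ∈ S, M.IsCircuit T)
    (hpriv : ∀ T ∈ S, ∃ p ∈ T, ∀ T' ∈ S, T' ≠ T → p ∉ T') :
    ∃ r : ℕ, M.eRk (⋃ T ∈ S, T) = r ∧ r + S.card ≤ (⋃ T ∈ S, T).ncard := by
  classical
  induction S using Finset.induction_on with
  | empty => exact ⟨0, by simp, by simp⟩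
  | @insert T S hTS ih =>
    have hS' : ∀ T' ∈ S, M.IsCircuit T' := fun T' h => hS T' (Finset.mem_insert_of_mem h)
    have hpriv' : ∀ T' ∈ S, ∃ p ∈ T', ∀ T'' ∈ S, T'' ≠ T' → p ∉ T'' := by
      intro T' h
      obtain ⟨p, hp, hp'⟩ := hpriv T' (Finset.mem_insert_of_mem h)
      exact ⟨p, hp, fun T'' h'' hne => hp' T'' (Finset.mem_insert_of_mem h'') hne⟩
    obtain ⟨r, hr, hle⟩ := ih hS' hpriv'
    rw [Finset.set_biUnion_insert, union_comm]
    set U' := ⋃ T' ∈ S, T' with hU'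
    have hU'E : U' ⊆ M.E := by
      intro t ht
      simp only [hU', mem_iUnion, exists_prop] at ht
      obtain ⟨T', hT', ht⟩ := ht
      exact (hS' T' hT').subset_ground ht
    have hU'f : U'.Finite := M.ground_finite.subset hU'E
    have hT : M.IsCircuit T := hS T (Finset.mem_insert_self T S)
    have hTf : T.Finite := M.ground_finite.subset hT.subset_ground
    obtain ⟨p, hpT, hp⟩ := hpriv T (Finset.mem_insert_self T S)
    have hpU' : p ∉ U' := by
      intro h
      simp only [hU', mem_iUnion, exists_prop] at h
      obtain ⟨T', hT', hpT'⟩ := h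
      exact hp T' (Finset.mem_insert_of_mem hT') (fun h => hTS (h ▸ hT')) hpT'
    -- the rank of `U' ∪ T` is at most `rank U' + |T ∖ U'| − 1`
    have hcl : U' ∪ T ⊆ M.closure (U' ∪ (T \ {p})) := by
      intro t ht
      rcases ht with ht | ht
      · exact M.subset_closure _ (union_subset hU'E (sdiff_subset.trans hT.subset_ground)) (Or.inl ht)
      · by_cases htp : t = p
        · subst htp
          exact M.closure_subset_closure subset_union_right (hT.mem_closure_sdiff_singleton_of_mem hpT)
        · exact M.subset_closure _ (union_subset hU'E (sdiff_subset.trans hT.subset_ground))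
            (Or.inr ⟨ht, fun h => htp (mem_singleton_iff.1 h)⟩)
    have hrk : M.eRk (U' ∪ T) ≤ M.eRk U' + ((T \ {p}) \ U').encard := by
      have h1 : M.eRk (U' ∪ T) ≤ M.eRk (U' ∪ (T \ {p})) := by
        have := M.eRk_mono hcl; rwa [Matroid.eRk_closure_eq] at this
      have h2 : U' ∪ (T \ {p}) = U' ∪ ((T \ {p}) \ U') := by
        ext t; simp only [mem_union, mem_sdiff, mem_singleton_iff]; tauto
      rw [h2] at h1
      exact h1.trans (M.eRk_union_le_eRk_add_encard _ _)
    obtain ⟨r', hr'⟩ := exists_eRk_eq_coe M (U' ∪ T)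
    refine ⟨r', hr', ?_⟩
    have hTU'f : (T \ U').Finite := hTf.subset sdiff_subset
    have hcardTp : ((T \ {p}) \ U').ncard = (T \ U').ncard - 1 := by
      have : (T \ {p}) \ U' = (T \ U') \ {p} := by
        ext t; simp only [mem_sdiff, mem_singleton_iff]; tauto
      have hpTU : p ∈ T \ U' := ⟨hpT, hpU'⟩
      rw [this, ncard_sdiff_singleton_of_mem hpTU]
    have hpTU : p ∈ T \ U' := ⟨hpT, hpU'⟩
    have hpos : 1 ≤ (T \ U').ncard := (ncard_pos hTU'f).2 ⟨p, hpTU⟩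
    have hfin2 : ((T \ {p}) \ U').Finite := hTf.subset (sdiff_subset.trans sdiff_subset)
    have hrk' : r' ≤ r + ((T \ U').ncard - 1) := by
      rw [hr', hr, ← hfin2.cast_ncard_eq, hcardTp] at hrk
      exact_mod_cast hrk
    have hunion : (U' ∪ T).ncard = U'.ncard + (T \ U').ncard := by
      rw [← Set.ncard_union_eq disjoint_sdiff_right hU'f hTU'f, union_sdiff_self]
    rw [Finset.card_insert_of_notMem hTS, hunion]
    omega

/-- **A SPREAD E-FREE CORE OF NULLITY `d ≥ 4` HAS AT MOST `d` TRIANGLES.** -/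
theorem ncard_triangles_le_nullity (M : Matroid α) [M.Finite]
    (hfree : ∀ e ∈ M.E, ∃ A ⊆ M.E \ {e}, e ∉ M.closure A ∧ e ∉ M.closure ((M.E \ {e}) \ A))
    (hns : ¬ ∃ W ⊆ M.E, W.ncard ≤ 9 ∧ W.encard = M.eRk W + 4) {d : ℕ} (hd : M.E.encard = M.eRank + d)
    (h4 : 4 ≤ d) : {C : Set α | M.IsCircuit C ∧ C.ncard = 3}.ncard ≤ d := by
  classical
  by_cases hA : ∃ W ⊆ M.E, W.ncard = 6 ∧ M.eRk W ≤ 3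
  · obtain ⟨W, hWE, hW6, hW3⟩ := hA
    exact (ncard_triangles_le_four_of_six M hfree hWE hW6
      (fun T hT hT3 => tri_subset_of_six M hfree hns hWE hW6 hW3 hT hT3)).trans h4
  · set 𝒯 := {C : Set α | M.IsCircuit C ∧ C.ncard = 3} with h𝒯
    have h𝒯f : 𝒯.Finite := M.ground_finite.finite_subsets.subset (fun C hC => hC.1.subset_ground)
    have hS : ∀ T ∈ h𝒯f.toFinset, M.IsCircuit T := fun T hT => ((Finite.mem_toFinset h𝒯f).1 hT).1
    have hpriv : ∀ T ∈ h𝒯f.toFinset, ∃ p ∈ T, ∀ T' ∈ h𝒯f.toFinset, T' ≠ T → p ∉ T' := by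
      intro T hT
      rw [Finite.mem_toFinset] at hT
      obtain ⟨p, hp, hp'⟩ := exists_private_of_no_six M hfree hns hA hT.1 hT.2
      exact ⟨p, hp, fun T' hT' hne => hp' T' ((Finite.mem_toFinset h𝒯f).1 hT').1 ((Finite.mem_toFinset h𝒯f).1 hT').2 hne⟩
    obtain ⟨r, hr, hle⟩ := eRk_add_card_le_ncard_biUnion M h𝒯f.toFinset hS hpriv
    set U := ⋃ T ∈ h𝒯f.toFinset, T with hU
    have hUE : U ⊆ M.E := by
      intro t ht
      simp only [hU, mem_iUnion, exists_prop] at ht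
      obtain ⟨T, hT, ht⟩ := ht
      exact (hS T hT).subset_ground ht
    have hUf : U.Finite := M.ground_finite.subset hUE
    -- the nullity of `U` is at most the nullity of `E`: `rank E ≤ rank U + |E ∖ U|`
    have hE : M.eRank ≤ M.eRk U + (M.E \ U).encard := by
      have h1 : M.eRank = M.eRk (U ∪ (M.E \ U)) := by rw [union_sdiff_cancel hUE, Matroid.eRk_ground]
      rw [h1]
      exact M.eRk_union_le_eRk_add_encard _ _
    obtain ⟨ρ, hρ⟩ := ENat.ne_top_iff_exists.1 (PercRepro.Matroid.eRank_ne_top_of_finite M)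
    have hEn : M.E.ncard = ρ + d := by
      have := hd
      rw [← M.ground_finite.cast_ncard_eq, ← hρ] at this
      exact_mod_cast this
    have hdiff : (M.E \ U).ncard = M.E.ncard - U.ncard := Set.ncard_sdiff hUE hUf
    have hE' : ρ ≤ r + (M.E \ U).ncard := by
      rw [← hρ, hr, ← (M.ground_finite.subset sdiff_subset).cast_ncard_eq] at hE
      exact_mod_cast hE
    have hUle : U.ncard ≤ M.E.ncard := ncard_le_ncard hUE M.ground_finite
    rw [← ncard_eq_toFinset_card _ h𝒯f] at hle
    omega

end S1

end PercRepro
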